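/-
Copyright: the b2b-balaban cell (near-miss cell 7), T⁴-continuum fan-out, lineage t4-ne7b-p1 (node U5c COUNT member).
Released under the licence of the surrounding project.
-/
import Summits.QuantumFields.BalabanUV.T4Continuum.Support.CountThresholdExit
import Literature.MathematicalPhysics.QuantumFieldTheory.Balaban1983to89.T4MatchingClosureSocket

/-!
# The count chain's exit plugged into the seam (ζ′) by name

Summits-side support leaf of the T⁴-continuum cell (rung (B)+1 on a FINITE torus only; NOT infinite volume, NOT the
mass gap, NOT the Clay statement; NOT a proof of the spine estimate NE7b).  Lineage `t4-ne7b-p1` (generation 21),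
node U5c.  [folklore] bookkeeping over the lineage's OWN typed carrier; nothing is quoted from print and nothing printed
is asserted; no `[cite:]` tag.

WHAT.  The row's exit concludes `∃ K₁ ≥ K₀, RelWeightBound l₀ T A B (fun K t => if K₁ ≤ K then Bad K t else ∅)
(indicator {K₁ ≤ K} W)` (`CountThresholdUniform.relWeightBoundZ_of_irThreshold`, `Bad := badOfClass π T Bad′`,
`W := Cn·recordsBudget …`); the seam `T4MatchingClosureSocket.hybridNE7_closure'_tail` consumes a plain
`RelWeightBound l₀ T A B Bad W` together with the NE7c socket `ShellWeightBound` and NE7's `ReindexedBudget` on the hybrid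
cores, all on the SAME families, and returns `∃ K₀, HybridNE7` for the `K₀`-shifted families.  §1
**`hybridNE7_of_eventually`**: the two compose with NO glue — shift everything by the exit's `K₁`
(`CountThresholdExit.relWeightBound_shift_of_eventually`, `T4MatchingClosureSocket.shellWeightBound_shift`,
`T4MatchingClosure.reindexedBudget_shift`, summable rates by `Summable.comp_injective`), then apply the seam; the result
is `HybridNE7` for the families shifted by `K₁ + K₂` (written `K ↦ K₁ + (K₂ + K)`; origins compose).  §2 the same
with the exit's hypotheses displayed: **`hybridNE7_of_irThresholdZ`** = `relWeightBoundZ_of_irThreshold` followed by §1 —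
so the node-U5 assembly takes the count member's exit BY NAME, the remaining inputs being exactly the NE7c socket, the
NE7 budget on the cores and the four summable rates.  §3 Sanity.

NOT DONE HERE.  `ShellWeightBound` (NE7c), `ReindexedBudget` (NE7) are BINDERS; nothing of the walls (ID) G-ne7bp1g9-1,
(E2)∕(R1) G-ne7bp1-1.  NE7b discharge: no date.

HONEST DEPENDENCY (cell): continuum YM on T⁴ ⇐ BetaPertH ∧ nine spine estimates (0/9 proved); BetaPertH ⇐ (D1) ∧ (D4)
∧ CAP+tail.  This file changes none of it.
-/

open Finset
open Literature.MathematicalPhysics.QuantumFieldTheory.Balaban1983to89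
open T4PersistenceDictionary T4PersistentHistoryCount T4BankedInduction T4PrintedShapeBanking
open T4WeightBudget T4GlobalDenominator T4LiveClassFibration T4LiveStructureGas T4LiveGasToTerms T4RecordPriceSeam
open T4PartnerMultiplicity T4IndicatorShell T4MatchingAssembly T4MatchingClosure T4MatchingClosureSocket
open Summit.QuantumFields.BalabanUV.T4Continuum.PlacementBatch
open Summit.QuantumFields.BalabanUV.T4Continuum.PlacementSkeleton
open Summit.QuantumFields.BalabanUV.T4Continuum.PartnerMultiplicityZ
open Summit.QuantumFields.BalabanUV.T4Continuum.Crowding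
open Summit.QuantumFields.BalabanUV.T4Continuum.CountThresholdUniform
open Summit.QuantumFields.BalabanUV.T4Continuum.CountThresholdExit

namespace Summit.QuantumFields.BalabanUV.T4Continuum.CountSeamJunction

noncomputable section

/-! ## §1 The junction: an eventual `RelWeightBound` + the socket + the core budget ⇒ `HybridNE7` from some origin -/

section Junction

variable {ι : Type*} [DecidableEq ι] {l₀ vol : ℝ} {T : ℕ → Finset ι} {A B shA shB : ℕ → ℝ → ι → ℝ}
  {Bad : ℕ → ℝ → Finset ι} {Cc Rr CcRec RrRec : ℕ → ℝ → ι → ℝ} {ν u s₂ c₀ r s W Wsh : ℕ → ℝ}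

/-- **THE JUNCTION.**  The count chain's conclusion shape (bad class emptied and weight zeroed below `K₁`), the NE7c
socket `ShellWeightBound` and the NE7 budget `ReindexedBudget` on the hybrid cores — on the SAME unshifted families — and
four summable rates give `HybridNE7` for the families shifted by `K₁ + K₂` for some `K₁ ≥ K₀`, `K₂`.  Proof: shift by
`K₁` (`relWeightBound_shift_of_eventually`, `shellWeightBound_shift`, `reindexedBudget_shift`), then
`hybridNE7_closure'_tail`. [folklore] -/
theorem hybridNE7_of_eventually {K₀ : ℕ}
    (hW : ∃ K₁, K₀ ≤ K₁ ∧ RelWeightBound l₀ T A B (fun K t => if K₁ ≤ K then Bad K t else ∅)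
      (Set.indicator {K | K₁ ≤ K} W))
    (hSh : ShellWeightBound l₀ T A B shA shB Wsh)
    (hTB : ReindexedBudget l₀ vol T (fun K t τ => A K t τ - shA K t τ) (fun K t τ => B K t τ - shB K t τ) Bad Cc Rr
      CcRec RrRec ν u s₂ c₀ r s)
    (hr : Summable r) (hu : Summable u) (hs : Summable s) (hs₂ : Summable s₂) :
    ∃ K₁ K₂, K₀ ≤ K₁ ∧ HybridNE7 l₀ vol (fun K => T (K₁ + (K₂ + K))) (fun K => A (K₁ + (K₂ + K)))
      (fun K => B (K₁ + (K₂ + K))) (fun K => Bad (K₁ + (K₂ + K))) (fun K => W (K₁ + (K₂ + K)))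
      (fun K => shA (K₁ + (K₂ + K))) (fun K => shB (K₁ + (K₂ + K))) (fun K => Wsh (K₁ + (K₂ + K)))
      (fun K => (r (K₁ + (K₂ + K)) + u (K₁ + (K₂ + K))) + (s (K₁ + (K₂ + K)) + s₂ (K₁ + (K₂ + K)))) := by
  obtain ⟨K₁, hK₁, hW1⟩ := relWeightBound_shift_of_eventually hW
  have hi : Function.Injective fun K : ℕ => K₁ + K := add_right_injective K₁
  obtain ⟨K₂, h⟩ := hybridNE7_closure'_tail hW1 (shellWeightBound_shift K₁ hSh) (reindexedBudget_shift K₁ hTB)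
    (hr.comp_injective hi) (hu.comp_injective hi) (hs.comp_injective hi) (hs₂.comp_injective hi)
  exact ⟨K₁, K₂, hK₁, h⟩

end Junction

/-! ## §2 The row's exit BY NAME into the seam -/

section Exit

variable {γ κ ι : Type*} [DecidableEq γ] [DecidableEq κ] [DecidableEq ι] {l₀ vol : ℝ} {K₀ : ℕ} {π : ℕ → ι → κ}
  {T : ℕ → Finset ι} {A A' shA shB : ℕ → ℝ → ι → ℝ} {Bad' : ℕ → ℝ → Finset κ} {dead dead' : ℕ → ℝ → ι → ℝ}
  {F Rf F' Rf' : ℕ → κ → ℝ} {nlow nup mlow mup : ℕ → ℝ → ℝ} {Cn : ℝ}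
  {Cc Rr CcRec RrRec : ℕ → ℝ → ι → ℝ} {ν u s₂ c₀ r s Wsh : ℕ → ℝ}

/-- **NE7b's COUNT EXIT INTO THE SEAM (ζ′).**  The hypotheses of `CountThresholdUniform.relWeightBoundZ_of_irThreshold`
(typed flow at the NAMED threshold `irThresholdZ`, the labelled prices `hlabZ`, live families, both `Regeneration`
runs — the census of what is not kernel: (ID), (E2)∕(R1), the flow from BetaPertH∕(B)), PLUS the NE7c socket
`ShellWeightBound l₀ T A A′ shA shB Wsh`, the NE7 budget `ReindexedBudget` on the hybrid cores with the bad set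
`badOfClass π T Bad′`, and four summable rates ⇒ `∃ K₁ ≥ K₀, ∃ K₂, HybridNE7` for the families shifted by `K₁ + K₂`,
with weight `Cn·recordsBudget ρ̄ κ₁ V Λ η̄ j⋆`.  One application of the exit, then §1. [folklore] -/
theorem hybridNE7_of_irThresholdZ {C : T4PrintedShapeBanking.Consts} {L rr : ℕ} {β₀ : ℝ}
    (h : ThresholdOK C L rr β₀)
    {Kz p σ ε θ : ℝ} (hKz : 1 ≤ Kz) (hp : 0 ≤ p) (h0 : 0 < σ) (h1 : σ < 1) (hε : 0 < ε) (hθ : 0 < θ)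
    (Cell : ℕ → ℕ → Finset γ) {V Λ : ℝ} (hV : 0 ≤ V) (hΛ : 0 < Λ)
    (hcell : ∀ K a, ((Cell K a).card : ℝ) ≤ V * Λ ^ a) (E Bk : ℕ → ℕ → Finset PEv)
    (hE : ∀ K j, ∀ e ∈ E K j, PEv.step e ∈ Ioc j K) (jstar : ℕ → ℕ) (hj : ∀ K, jstar K ≤ K) {c : ℝ} (hc : 0 < c)
    (hfrac : ∀ K : ℕ, c * K ≤ ((K - jstar K : ℕ) : ℝ))
    (hA : Regeneration l₀ π T A Bad' dead F Rf nlow nup Cn K₀)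
    (hA' : Regeneration l₀ π T A' Bad' dead' F' Rf' mlow mup Cn K₀) (hCn : 0 ≤ Cn)
    (R : ℕ → ℕ → ℕ) (g : ℕ → ℕ → ℝ) (β' : ℕ → ℝ)
    (h27 : ∀ K, K₀ ≤ K → B14.FlowIneq27 (g K) (β' K) β₀ C.p₀ K)
    (h29 : ∀ K, K₀ ≤ K → B14FlowStep.FlowIneq29 (R K) (g K) L (β' K) β₀ K)
    (hR : ∀ K, K₀ ≤ K → ∀ s, s ≤ K → B14.IsRj L rr (g K s) (R K s))
    (hx1 : ∀ K, K₀ ≤ K → ∀ s, s ≤ K → 1 ≤ Real.log ((g K s) ^ 2)⁻¹)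
    (hir : ∀ K, K₀ ≤ K → irThresholdZ C Kz p σ ε θ L rr β₀ ≤ Real.log ((g K K) ^ 2)⁻¹)
    {ρbar ηbar : ℝ} (hρbar : ∀ K j, ∑ b ∈ Bk K j, rho C (g K) b ≤ ρbar)
    (hηbar : ∀ K j, ∀ t ∈ Ioc j K, ∑ e ∈ E K j with PEv.step e = t, eta C e ≤ ηbar)
    (hrate : Λ * Real.exp (ηbar - C.κ₁) < 1) {Λ' : ℝ} (hΛ0 : 0 ≤ Λ') (hΛ1 : Λ' * Real.exp ε * Real.exp (-C.κ₁) ≤ 1)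
    (y : ℕ → ℕ → γ → PEv → Finset PEv → ℝ)
    (hy0 : ∀ K, ∀ j ≤ K, ∀ z ∈ Cell K (K - j), ∀ b ∈ Bk K j,
      ∀ Q ∈ records (dictW (R K) C.n₁) j K (E K j) b, 0 ≤ y K j z b Q)
    (hlabZ : ∀ K, K₀ ≤ K → ∀ j ≤ K, ∀ z ∈ Cell K (K - j), ∀ b ∈ Bk K j,
      ∀ Q ∈ records (dictW (R K) C.n₁) j K (E K j) b,
      y K j z b Q ≤ 0 ∨ ∃ G : Gen PEv, Consistent C K (R K) G ∧ G.WF (dictW (R K) C.n₁) ∧ G.rootStep = j ∧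
        K < G.reach (dictW (R K) C.n₁) ∧ G.root = b ∧ G.events.erase G.root = Q ∧
        y K j z b Q ≤ Kz ^ (merges G).card * (∏ e ∈ merges G, Crowding.Q (wcnt G) σ e.step ^ p) *
          Λ' ^ partnerAges PEv.step G * (Real.exp (-credits (credit C (g K)) G) *
            Real.exp (lifeCost (dictW (R K) C.n₁) (cost C K (R K)) G)))
    (str : ℕ → κ → Finset (Slot γ PEv))
    (hinj : ∀ K t, |t| ≤ l₀ → K₀ ≤ K → Set.InjOn (str K) (Bad' K t))
    (hstr : ∀ K t, |t| ≤ l₀ → K₀ ≤ K → ∀ cl ∈ Bad' K t,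
      str K cl ⊆ liveSlots Cell (dictW (R K) C.n₁) E Bk K ∧
        ∃ o ∈ oldSlots Cell (dictW (R K) C.n₁) E Bk jstar K, o ∈ str K cl)
    (hF : ∀ K t, |t| ≤ l₀ → K₀ ≤ K → ∀ cl ∈ Bad' K t, F K cl * Rf K cl ≤ famWeight (slotPrice (y K)) (str K cl))
    (hF' : ∀ K t, |t| ≤ l₀ → K₀ ≤ K → ∀ cl ∈ Bad' K t, F' K cl * Rf' K cl ≤ famWeight (slotPrice (y K)) (str K cl))
    -- the seam's other inputs (NE7c socket, NE7 core budget, summable producer rates)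
    (hSh : ShellWeightBound l₀ T A A' shA shB Wsh)
    (hTB : ReindexedBudget l₀ vol T (fun K t τ => A K t τ - shA K t τ) (fun K t τ => A' K t τ - shB K t τ)
      (badOfClass π T Bad') Cc Rr CcRec RrRec ν u s₂ c₀ r s)
    (hr : Summable r) (hu : Summable u) (hs : Summable s) (hs₂ : Summable s₂) :
    ∃ K₁ K₂, K₀ ≤ K₁ ∧ HybridNE7 l₀ vol (fun K => T (K₁ + (K₂ + K))) (fun K => A (K₁ + (K₂ + K)))
      (fun K => A' (K₁ + (K₂ + K))) (fun K => badOfClass π T Bad' (K₁ + (K₂ + K)))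
      (fun K => Cn * recordsBudget ρbar C.κ₁ V Λ ηbar jstar (K₁ + (K₂ + K)))
      (fun K => shA (K₁ + (K₂ + K))) (fun K => shB (K₁ + (K₂ + K))) (fun K => Wsh (K₁ + (K₂ + K)))
      (fun K => (r (K₁ + (K₂ + K)) + u (K₁ + (K₂ + K))) + (s (K₁ + (K₂ + K)) + s₂ (K₁ + (K₂ + K)))) :=
  hybridNE7_of_eventually
    (relWeightBoundZ_of_irThreshold h hKz hp h0 h1 hε hθ Cell hV hΛ hcell E Bk hE jstar hj hc hfrac hA hA' hCn R g
      β' h27 h29 hR hx1 hir hρbar hηbar hrate hΛ0 hΛ1 y hy0 hlabZ str hinj hstr hF hF')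
    hSh hTB hr hu hs hs₂

end Exit

/-! ## §3 Sanity -/

namespace Sanity

/-- the junction on the trivial datum of `CountThresholdExit.Sanity`: an eventual `RelWeightBound` in the exit's shape
is, in particular, a plain one after a shift (the §1 mechanism minus the seam). [folklore] -/
example {K₀ : ℕ} {W : ℕ → ℝ} {Bad : ℕ → ℝ → Finset Unit}
    (hW : ∃ K₁, K₀ ≤ K₁ ∧ RelWeightBound (ι := Unit) 1 (fun _ => ∅) (fun _ _ _ => 0) (fun _ _ _ => 0)
      (fun K t => if K₁ ≤ K then Bad K t else ∅) (Set.indicator {K | K₁ ≤ K} W)) :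
    ∃ K₁, K₀ ≤ K₁ ∧ RelWeightBound (ι := Unit) 1 (fun _ => ∅) (fun _ _ _ => 0) (fun _ _ _ => 0)
      (fun K => Bad (K₁ + K)) fun K => W (K₁ + K) :=
  relWeightBound_shift_of_eventually hW

end Sanity

end

end Summit.QuantumFields.BalabanUV.T4Continuum.CountSeamJunction
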